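import Summits.QuantumFields.BalabanUV.Beta.D1BFx.WilsonStencilRealised
import Summits.QuantumFields.BalabanUV.Beta.VecTableZ4

/-!
# `BalabanUV.Beta.D1BFx.ModelTablesRealised` — road «BF-x» for binder row D1, slot (SPLIT) ∕ leaf A1.ii, part 4a: an3's MODEL VECTOR AND GHOST
# TABLES IN THE ROAD'S CURRENCY — over a frozen EVEN fibre-diagonal leg `δ_{ab}·g (y − x)` the road's `ExpKernelCalculus.bubble` of the kernel
# realisations of an3's colourless `vecStn s` (direction-reindexed) and `ghostStn` lists are `8·cellForm g − 2s²·D(g²)` and `2·cellForm g`; their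
# three-sector combination times the colour weight `−2N²` is `SpinTable.bfKernel g N` — `SquareTable.stK`'s closed form up to the `w_μw_ν` weight

HONEST DEPENDENCY (page 1, mandatory): continuum YM on T⁴ ⇐ BetaPertH ∧ nine spine estimates (0/9 proved); BetaPertH ⇐ (D1) ∧ (D4) ∧
CAP+tail; G-an2-4 gates asym, D1 and NE2/3/4.  HONEST FRAMING (cell contract, verbatim): «discharging `BetaPertH` makes Bałaban's UV
stability UNCONDITIONAL — a real constructive-QFT result; it is NOT the continuum limit and NOT the Clay problem.»  THIS MODULE DISCHARGES
NOTHING of the wall: [folklore] bookkeeping BY NAME over an3's `VecTableZ4.bub_vec_vec_cell` ∕ `bub_ghost_ghost_cell` (the `ℤ⁴` model tables, even leg,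
`μ ≠ ν`), an3's `SpinTable.bfKernel` ∕ `SquareTable.stK_eq_closedForm`, and this unit's parts 2–3 (`StencilRealisation.bubble_realK_realK`,
`WilsonStencilRealised.reixStn`); ONE definition with a body ([our object] `ιUEquiv`, the colourless re-indexing as an `Equiv`; asserts nothing).  No `Prop` minted, nothing printed asserted, 0 sorry.  0 wall binders; NOT D1, NOT `BetaPertH`, NOT continuum, NOT Clay.

ABSOLUTE RULE (cell charter, verbatim): «No internally-minted statement may enter as a cited fact. Every hypothesis is either kernel-proved in
this package or a verbatim quotation of a PUBLISHED theorem with page reference. The manuscript(s) under audit are NOT citable for their own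
disputed steps — they are the thing under adjudication; programme-internal (2001/route/tribunal) claims are never citable.»

WHY (skeleton v1.6 slot (SPLIT) = A0 ∘ A1.ii).  Part 3 put the road's E-sector stencil into an3's list currency (`SbE κ u = realK u u (sbEStn κ)`,
`sbEStn κ = ½•(reix W ++ (−1)•tr (reix W))`, `W = wilsonStn κ 1 = vecStn sTot ++ 2•divStn ++ remStn`).  The MAIN term of (SPLIT) is the model part: the
`vecStn` block against itself and the ghost current against itself, over the FROZEN leg at the base point.  THIS FILE evaluates exactly those two
tables in the road's currency (§2), so that what remains of A1.ii is LIST ALGEBRA only (A0's split of `sbEStn`: antisymmetrisation of `reix (vecStn sTot)`,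
the local Feynman completion cancelling `2•divStn`, `remStn` = degree ≥ 7 class) plus the base-bond ∕ corner index conventions of the final assembly.
* §1 `bub_reixStn` — an3's `bub` is invariant under internal re-indexing of both lists along an `Equiv` (the trace of a product is).
* §2 **`bubble_vecStn_frozen`**: `g` even, `μ ≠ ν`, frozen leg `A x y a b = δ_{ab}·g (y − x)`, first vertex at base site `u`, second at `u + (v + u_μ)`:
  `bubble A (realK u u (reixStn ιU (vecStn s μ 1))) (realK (u+(v+u_μ)) (u+(v+u_μ)) (reixStn ιU (vecStn s ν 1))) = 8·cellForm g u_μ u_ν v − s²·(2·D_{μν}(g²) v)`;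
  **`bubble_ghostStn_frozen`** (fibre `Unit`, the road's ghost fibre): `= 2·cellForm g u_μ u_ν v`;
  **`three_sectors_frozen`**: `½·(vector table) − (ghost table) = 2·cellForm g u_μ u_ν v − s²·D_{μν}(g²) v`;
  **`three_sectors_frozen_bfKernel`** (`s² = 4`, colour weight `−2N²` = `ColourTrace.trace_adMat_gen_sq`'s value, here a FACTOR not a hypothesis):
  `(−2N²)·(½·V − G) = bfKernel g N u_μ u_ν v`, and `stK μ ν N g v = v_μ v_ν · bfKernel g N u_μ u_ν v` (`stK_of_bfKernel`, from `stK_eq_closedForm`).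
Unit `b2b-balaban-beta-d1-p2` (road owner, gen 2); `LEAVES-BFx.md` row A1.ii (part 4a).
-/

open Finset
open scoped BigOperators
open Literature.MathematicalPhysics.QuantumFieldTheory.Balaban1983to89
open Literature.MathematicalPhysics.QuantumFieldTheory.Balaban1983to89.Beta
open ExpKernelCalculus (Site MKer bubble)
open DyadicShell (Pt toReal)
open BubbleTransfer (unitVec)
open GradedBubbles (LP Stn Fam term bubRow bub)
open GhostTable (cellForm mixedDiffFun)
open SpinTable (bfKernel)
open SquareTable (stK stK_eq_closedForm)
open Summit.QuantumFields.BalabanUV.Beta.VecTableZ4 (ghostStn bub_vec_vec_cell bub_ghost_ghost_cell)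
open Summit.QuantumFields.BalabanUV.Beta.WilsonStencilZ4 (vecStn)
open Summit.QuantumFields.BalabanUV.Beta.D1BFx.StencilRealisation (realK bubble_realK_realK trace_mul_eq_sum)
open Summit.QuantumFields.BalabanUV.Beta.D1BFx.WilsonStencilRealised (reixStn reixStn_nil reixStn_cons ιU)

namespace Summit.QuantumFields.BalabanUV.Beta.D1BFx.ModelTablesRealised

/-! ## §1 `bub` is invariant under internal re-indexing along an `Equiv` -/

section Reindex

variable {I J : Type*} [Fintype I] [Fintype J]

/-- [folklore] The trace of a product is invariant under simultaneous re-indexing along an `Equiv`. -/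
theorem trace_submatrix_mul_submatrix (e : J ≃ I) (m m' : Matrix I I ℝ) :
    (m.submatrix e e * m'.submatrix e e).trace = (m * m').trace := by
  rw [trace_mul_eq_sum, trace_mul_eq_sum]
  simp only [Matrix.submatrix_apply]
  rw [e.sum_comp (fun a => ∑ f : J, m a (e f) * m' (e f) a)]
  exact sum_congr rfl fun a _ => e.sum_comp (fun f => m a f * m' f a)

/-- [folklore] `term` is invariant under re-indexing along an `Equiv`. -/
theorem term_reix (e : J ≃ I) (f₁ f₂ : Fam) (p q : LP I) :
    term f₁ f₂ (⟨p.x, p.y, p.m.submatrix e e⟩ : LP J) ⟨q.x, q.y, q.m.submatrix e e⟩ = term f₁ f₂ p q := by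
  funext L k w
  simp only [term, trace_submatrix_mul_submatrix]

/-- [folklore] `bubRow` is invariant under re-indexing along an `Equiv`. -/
theorem bubRow_reixStn (e : J ≃ I) (f₁ f₂ : Fam) (p : LP I) (W : Stn I) :
    bubRow f₁ f₂ (⟨p.x, p.y, p.m.submatrix e e⟩ : LP J) (reixStn e W) = bubRow f₁ f₂ p W := by
  induction W with
  | nil => rfl
  | cons q W ih => rw [reixStn_cons, bubRow, bubRow, ih, term_reix]

/-- [folklore] **an3's `bub` IS INVARIANT UNDER INTERNAL RE-INDEXING OF BOTH LISTS ALONG AN `Equiv`.** -/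
theorem bub_reixStn (e : J ≃ I) (f₁ f₂ : Fam) (V W : Stn I) :
    bub f₁ f₂ (reixStn e V) (reixStn e W) = bub f₁ f₂ V W := by
  induction V with
  | nil => rfl
  | cons p V ih => rw [reixStn_cons, bub, bub, ih, bubRow_reixStn]

/-- [folklore] The colourless re-indexing `ιU : Fin 4 → Unit × Fin 4` is a bijection. -/
def ιUEquiv : Fin 4 ≃ Unit × Fin 4 where
  toFun := ιU
  invFun := fun p => p.2
  left_inv := fun _ => rfl
  right_inv := fun p => by cases p with | mk u α => cases u; rfl

/-- [folklore] `reixStn ιU = reixStn ιUEquiv`. -/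
theorem reixStn_ιU {V : Stn (Unit × Fin 4)} : reixStn ιU V = reixStn (ιUEquiv : Fin 4 → Unit × Fin 4) V := rfl

end Reindex

/-! ## §2 The model tables in the road's currency -/

section Tables

variable (g : Pt → ℝ)

/-- [folklore] The constant leg family of an even leg is even in an3's sense. -/
theorem even_const_fam (hg : ∀ w, g (-w) = g w) : ∀ (L k : ℕ) (w : Pt), (fun _ _ => g : Fam) L k (-w) = (fun _ _ => g : Fam) L k w :=
  fun _ _ w => hg w

/-- [folklore] `trace (1 · 1) = 1` on the one-point colour index. -/
theorem trace_one_unit : Matrix.trace ((1 : Matrix Unit Unit ℝ) * 1) = 1 := by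
  rw [Matrix.mul_one, Matrix.trace_one, Fintype.card_unit, Nat.cast_one]

/-- [folklore] **THE MODEL VECTOR TABLE IN THE ROAD'S CURRENCY.**  `g` even, `μ ≠ ν`, frozen fibre-diagonal leg `A x y a b = δ_{ab}·g (y − x)`, first
vertex realised at the base site `u`, second at `u + (v + u_μ)`:
`bubble A (realK u u (reix (vecStn s μ 1))) (realK … (reix (vecStn s ν 1))) = 8·cellForm g u_μ u_ν v − s²·(2·D_{μν}(g²) v)` (an3's `bub_vec_vec_cell` at
`A = A′ = 1`, `trace(AA′) = 1`). -/
theorem bubble_vecStn_frozen (hg : ∀ w, g (-w) = g w) {A : MKer 4 (Fin 4)} (hA : ∀ x y a b, A x y a b = if a = b then g (y - x) else 0)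
    {μ ν : Fin 4} (hμν : μ ≠ ν) (s : ℝ) (u v : Pt) :
    bubble A (realK u u (reixStn ιU (vecStn s μ (1 : Matrix Unit Unit ℝ))))
        (realK (u + (v + unitVec μ)) (u + (v + unitVec μ)) (reixStn ιU (vecStn s ν (1 : Matrix Unit Unit ℝ)))) =
      8 * cellForm g (unitVec μ) (unitVec ν) v - s ^ 2 * (2 * mixedDiffFun (fun w => g w ^ 2) (unitVec μ) (unitVec ν) v) := by
  rw [bubble_realK_realK g hA _ _ u (v + unitVec μ) 0 0, reixStn_ιU, reixStn_ιU, bub_reixStn, bub_vec_vec_cell (even_const_fam g hg) hμν,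
    trace_one_unit]
  ring

/-- [folklore] **THE MODEL GHOST TABLE IN THE ROAD'S CURRENCY** (ghost fibre `Unit`): `g` even, frozen leg, first ghost current at `u`, second at `u + (v + u_μ)`:
`bubble A (realK u u (ghostStn μ 1)) (realK … (ghostStn ν 1)) = 2·cellForm g u_μ u_ν v` (an3's `bub_ghost_ghost_cell` at `m = m′ = 1`). -/
theorem bubble_ghostStn_frozen (hg : ∀ w, g (-w) = g w) {A : MKer 4 Unit} (hA : ∀ x y a b, A x y a b = if a = b then g (y - x) else 0)
    (μ ν : Fin 4) (u v : Pt) :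
    bubble A (realK u u (ghostStn μ (1 : Matrix Unit Unit ℝ))) (realK (u + (v + unitVec μ)) (u + (v + unitVec μ)) (ghostStn ν (1 : Matrix Unit Unit ℝ))) =
      2 * cellForm g (unitVec μ) (unitVec ν) v := by
  rw [bubble_realK_realK g hA _ _ u (v + unitVec μ) 0 0, bub_ghost_ghost_cell (even_const_fam g hg), trace_one_unit]
  ring

/-- [folklore] **THREE SECTORS IN THE ROAD'S CURRENCY**: half the vector table minus the ghost table is `2·cellForm g u_μ u_ν v − s²·D_{μν}(g²) v`
(an3's `three_sectors_Z4` ∕ `SpinTable.three_sectors_four_two` shape at `trace(AA′) = 1`). -/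
theorem three_sectors_frozen (hg : ∀ w, g (-w) = g w) {A : MKer 4 (Fin 4)} (hA : ∀ x y a b, A x y a b = if a = b then g (y - x) else 0)
    {B : MKer 4 Unit} (hB : ∀ x y a b, B x y a b = if a = b then g (y - x) else 0) {μ ν : Fin 4} (hμν : μ ≠ ν) (s : ℝ) (u v : Pt) :
    (1 / 2 : ℝ) * bubble A (realK u u (reixStn ιU (vecStn s μ (1 : Matrix Unit Unit ℝ))))
        (realK (u + (v + unitVec μ)) (u + (v + unitVec μ)) (reixStn ιU (vecStn s ν (1 : Matrix Unit Unit ℝ))))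
      - bubble B (realK u u (ghostStn μ (1 : Matrix Unit Unit ℝ)))
        (realK (u + (v + unitVec μ)) (u + (v + unitVec μ)) (ghostStn ν (1 : Matrix Unit Unit ℝ))) =
      2 * cellForm g (unitVec μ) (unitVec ν) v - s ^ 2 * mixedDiffFun (fun w => g w ^ 2) (unitVec μ) (unitVec ν) v := by
  rw [bubble_vecStn_frozen g hg hA hμν, bubble_ghostStn_frozen g hg hB]
  ring

/-- [folklore] **… TIMES THE COLOUR WEIGHT `−2N²` AT `s² = 4` IT IS an3's REALISED KERNEL `bfKernel g N u_μ u_ν v`** (`= 8N²·D_{μν}(g²) − 4N²·cellForm g`;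
the weight is the value of `ColourTrace.trace_adMat_gen_sq`, here applied as an explicit factor — the road's colour weights live in slot (K)). -/
theorem three_sectors_frozen_bfKernel (hg : ∀ w, g (-w) = g w) {A : MKer 4 (Fin 4)} (hA : ∀ x y a b, A x y a b = if a = b then g (y - x) else 0)
    {B : MKer 4 Unit} (hB : ∀ x y a b, B x y a b = if a = b then g (y - x) else 0) {μ ν : Fin 4} (hμν : μ ≠ ν) {s : ℝ} (hs : s ^ 2 = 4)
    (N : ℝ) (u v : Pt) :
    -(2 * N ^ 2) * ((1 / 2 : ℝ) * bubble A (realK u u (reixStn ιU (vecStn s μ (1 : Matrix Unit Unit ℝ))))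
        (realK (u + (v + unitVec μ)) (u + (v + unitVec μ)) (reixStn ιU (vecStn s ν (1 : Matrix Unit Unit ℝ))))
      - bubble B (realK u u (ghostStn μ (1 : Matrix Unit Unit ℝ)))
        (realK (u + (v + unitVec μ)) (u + (v + unitVec μ)) (ghostStn ν (1 : Matrix Unit Unit ℝ)))) =
      bfKernel g N (unitVec μ) (unitVec ν) v := by
  rw [three_sectors_frozen g hg hA hB hμν, hs, bfKernel]
  ring

/-- [folklore] **`stK` IS THE WEIGHTED `bfKernel`**: `stK μ ν N g v = v_μ · v_ν · bfKernel g N u_μ u_ν v` (`SquareTable.stK_eq_closedForm`). -/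
theorem stK_of_bfKernel (μ ν : Fin 4) (N : ℝ) (v : Pt) :
    stK μ ν N g v = toReal v μ * toReal v ν * bfKernel g N (unitVec μ) (unitVec ν) v := by
  rw [stK_eq_closedForm, bfKernel]

end Tables

end Summit.QuantumFields.BalabanUV.Beta.D1BFx.ModelTablesRealised
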